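import Mathlib

/-!
# (P7) is SAT — an explicit ℤ/4-symmetric 5 × 8 determinantal design at the decomposable ℚ(i) member

Scratch plate of the transfer lens (`plan-lens-HodgeAV-transfer` g21; crux H2 = `BlochSeedDiscOne`,
item stmt-HodgeConjecture-18881). CENSUS-NEUTRAL, pure commutative algebra + decidable integer checks:

* `w₁ w₂ s` are three commuting indeterminates standing for `ω₁ = pr₁^*θ`, `ω₂ = pr₂^*θ` and the cross class
  `S = m^*θ − ω₁ − ω₂` in `NS(J × J) ⊗ ℚ` (`J` a principally polarised abelian fourfold, `P₀ = J × J`,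
  `ψ₀ = J₀ : (x,y) ↦ (−y,x)`); a class `a·ω₁ + b·ω₂ + c·S` is the symmetric matrix `[[a,c],[c,b]]`, ample iff
  `a > 0 ∧ ab − c² > 0`, and `h = ω₁ + ω₂`, `D = ω₁ − ω₂`, `z = D + iS`, `Re z⁴ = D⁴ − 6D²S² + S⁴`,
  `Im z⁴ = 4D³S − 4DS³` (the rational basis of the Weil plane `W_{ℚ(i)} ⊗ ℂ = ⟨z⁴, z̄⁴⟩`).
* `Mtab` (8 classes) and `Ntab` (5 classes) are the summands of `M = ⊕ L_{m_j}` and `N = ⊕ L_{n_i}`; the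
  determinantal fourfold is `Z = D₄(φ)`, `φ : N → M` general, with Porteous class `[Z] = c₄(M − N)`.
* THEOREMS: (1) `newton_c4` — `24·c₄(M − N)` written through the power sums `p_k = Σ m_j^k − Σ n_i^k`
  (Newton) equals `24·(2106081·h⁴ + 24·Re z⁴ − 18·Im z⁴)`; (2) `whitney_c4` — the same value for `s₄` defined by
  the Whitney recursion `c(M) = c(N)·s`; (3) `all_differences_ample` — all 40 classes `m_j − n_i` are positive
  definite; (4) `Mtab_rot`/`Ntab_rot` — both tables are unions of orbits of the ℚ-rational quarter turn
  `c ↦ i·c` of the plane `⟨D, S⟩`; (5) the generic ORBIT-SUM identities of the moment method and the pen checks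
  (i), (ii), gauge of the memo; (6) the conic parametrisation used to find the radii.

Nothing here is a statement about schemes or cohomology; the geometric reading (Porteous, Kleiman–Bertini,
Fulton–Lazarsfeld connectedness, Lefschetz `2L` globally generated) is in `DETERMINANTAL-SEED-TRANSFER-g21.md`.
HC / HC_CM / HC_AV / stmt 18881 / H2 are NOT proved by anything in this file.
-/

namespace H21Scratch.TransferDeterminantalSeed

/-! ### The tables -/

/-- The eight summands of `M`, as `(a, b, c) ↔ a·ω₁ + b·ω₂ + c·S`. Two ℤ/4-orbits: heights 9 (radius² 20,
`a₁ = 4 + 2i`) and 18 (radius² 9, `a₂ = 3`). -/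
def Mtab : List (ℤ × ℤ × ℤ) :=
  [(13, 5, 2), (7, 11, 4), (5, 13, -2), (11, 7, -4), (21, 15, 0), (18, 18, 3), (15, 21, 0), (18, 18, -3)]

/-- The five summands of `N`: one ℤ/4-orbit at height 0 (radius² 17, `a₃ = 4 + i`) and the axis point `𝒪`. -/
def Ntab : List (ℤ × ℤ × ℤ) :=
  [(0, 0, 0), (4, -4, 1), (-1, 1, 4), (-4, 4, -1), (1, -1, -4)]

/-- Positive definiteness of `[[a,c],[c,b]]`, i.e. ampleness of `a·ω₁ + b·ω₂ + c·S` on `J × J`. -/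
def isPD (x : ℤ × ℤ × ℤ) : Bool :=
  decide (0 < x.1 ∧ 0 < x.1 * x.2.1 - x.2.2 ^ 2)

/-- componentwise difference of two classes -/
def diff (m n : ℤ × ℤ × ℤ) : ℤ × ℤ × ℤ := (m.1 - n.1, m.2.1 - n.2.1, m.2.2 - n.2.2)

/-- **All 40 differences `m_j − n_i` are ample** (so `Hom(N, M) = ⊕ L_{m_j − n_i}` is ample, and its double is
ample and globally generated). -/
theorem all_differences_ample :
    (Mtab.all fun m => Ntab.all fun n => isPD (diff m n)) = true := by
  decide

/-- every summand of `M` is itself ample (not needed, recorded) -/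
theorem M_ample : (Mtab.all isPD) = true := by decide

/-- The quarter turn `c ↦ i·c` of the plane `⟨D, S⟩` (`(β, γ) ↦ (−γ, β)` with `a = α + β`, `b = α − β`,
`c = γ`), written on `(a, b, c)`; integral on our tables because `a ≡ b (mod 2)` there. -/
def rot (x : ℤ × ℤ × ℤ) : ℤ × ℤ × ℤ :=
  ((x.1 + x.2.1) / 2 - x.2.2, (x.1 + x.2.1) / 2 + x.2.2, (x.1 - x.2.1) / 2)

theorem Mtab_parity : (Mtab.all fun x => x.1 % 2 == x.2.1 % 2) = true := by decide
theorem Ntab_parity : (Ntab.all fun x => x.1 % 2 == x.2.1 % 2) = true := by decide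

/-- `Mtab` is a union of ℤ/4-orbits. -/
theorem Mtab_rot : (Mtab.map rot).Perm Mtab := by decide
/-- `Ntab` is a union of ℤ/4-orbits. -/
theorem Ntab_rot : (Ntab.map rot).Perm Ntab := by decide
/-- `rot ∘ rot` is the involution `J₀^* : (a,b,c) ↦ (b,a,−c)` on both tables. -/
theorem rot_rot_M : (Mtab.map (rot ∘ rot)) = Mtab.map (fun x => (x.2.1, x.1, -x.2.2)) := by decide
theorem rot_rot_N : (Ntab.map (rot ∘ rot)) = Ntab.map (fun x => (x.2.1, x.1, -x.2.2)) := by decide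

/-! ### The class identity -/

section ClassIdentity

variable {R : Type*} [CommRing R]

/-- the class `a·ω₁ + b·ω₂ + c·S` of a table entry -/
def cls (w₁ w₂ s : R) (x : ℤ × ℤ × ℤ) : R := (x.1 : R) * w₁ + (x.2.1 : R) * w₂ + (x.2.2 : R) * s

/-- elementary symmetric functions of a list: `esy l k = e_k(l)` (`e_0 = 1`, `e_k([]) = 0` for `k ≥ 1`). -/
def esy : List R → ℕ → R
  | [] => fun k => if k = 0 then 1 else 0
  | x :: xs => fun k => if k = 0 then 1 else esy xs k + x * esy xs (k - 1)

/-- power sum `Σ x^k` of a list -/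
def psum : List R → ℕ → R
  | [] => fun _ => 0
  | x :: xs => fun k => x ^ k + psum xs k

variable (w₁ w₂ s : R)

/-- the classes `m_1, …, m_8` -/
def Mcls : List R := Mtab.map (cls w₁ w₂ s)
/-- the classes `n_1, …, n_5` -/
def Ncls : List R := Ntab.map (cls w₁ w₂ s)

/-- `p_k = Σ_j m_j^k − Σ_i n_i^k` (power sums of the virtual bundle `M − N`) -/
def p (k : ℕ) : R := psum (Mcls w₁ w₂ s) k - psum (Ncls w₁ w₂ s) k

/-- `h = ω₁ + ω₂` -/
def h : R := w₁ + w₂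
/-- `Re z⁴ = D⁴ − 6 D² S² + S⁴`, `D = ω₁ − ω₂` -/
def reZ4 : R := (w₁ - w₂) ^ 4 - 6 * (w₁ - w₂) ^ 2 * s ^ 2 + s ^ 4
/-- `Im z⁴ = 4 D³ S − 4 D S³` -/
def imZ4 : R := 4 * (w₁ - w₂) ^ 3 * s - 4 * (w₁ - w₂) * s ^ 3

/-- the target class `q·h⁴ + u·Re z⁴ + v·Im z⁴` with `q = 2106081 = 3⁹·107`, `(u, v) = (24, −18)` -/
def target : R := 2106081 * h w₁ w₂ ^ 4 + 24 * reZ4 w₁ w₂ s - 18 * imZ4 w₁ w₂ s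

/-- **Newton form.** `24·c₄(M − N) = p₁⁴ − 6p₁²p₂ + 3p₂² + 8p₁p₃ − 6p₄` equals `24·(q h⁴ + u Re z⁴ + v Im z⁴)`. -/
theorem newton_c4 :
    p w₁ w₂ s 1 ^ 4 - 6 * p w₁ w₂ s 1 ^ 2 * p w₁ w₂ s 2 + 3 * p w₁ w₂ s 2 ^ 2
      + 8 * p w₁ w₂ s 1 * p w₁ w₂ s 3 - 6 * p w₁ w₂ s 4 = 24 * target w₁ w₂ s := by
  simp only [p, Mcls, Ncls, Mtab, Ntab, List.map, cls, psum, target, h, reZ4, imZ4]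
  push_cast
  ring

/-- total Chern class coefficients `c_k(M)`, `c_k(N)` -/
def cM (k : ℕ) : R := esy (Mcls w₁ w₂ s) k
def cN (k : ℕ) : R := esy (Ncls w₁ w₂ s) k

/-- Whitney recursion `c(M) = c(N)·s`: `s_k = c_k(M) − Σ_{b=1}^{k} c_b(N) s_{k−b}` -/
def s₁ : R := cM w₁ w₂ s 1 - cN w₁ w₂ s 1
def s₂ : R := cM w₁ w₂ s 2 - cN w₁ w₂ s 1 * s₁ w₁ w₂ s - cN w₁ w₂ s 2
def s₃ : R := cM w₁ w₂ s 3 - cN w₁ w₂ s 1 * s₂ w₁ w₂ s - cN w₁ w₂ s 2 * s₁ w₁ w₂ s - cN w₁ w₂ s 3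
def s₄ : R := cM w₁ w₂ s 4 - cN w₁ w₂ s 1 * s₃ w₁ w₂ s - cN w₁ w₂ s 2 * s₂ w₁ w₂ s
  - cN w₁ w₂ s 3 * s₁ w₁ w₂ s - cN w₁ w₂ s 4

/-- **Whitney form.** `s₄ = c₄(M − N) = 2106081·h⁴ + 24·Re z⁴ − 18·Im z⁴` in `ℤ[ω₁, ω₂, S]`. -/
theorem whitney_c4 : s₄ w₁ w₂ s = target w₁ w₂ s := by
  simp only [s₄, s₃, s₂, s₁, cM, cN, Mcls, Ncls, Mtab, Ntab, List.map, cls, esy, target, h, reZ4, imZ4]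
  norm_num
  ring

/-! ### Degree 10: the canonical-class survival test (V₄¹)

DICTIONARY (pen; n = 4 transfer of Theorem B of `Literature/AlgebraicGeometry/HodgeTheory/WeilClassTestCanonicalObstruction.lean`).
`Z ≅ Z̃ ⊂ ℙ(N)` (lines in `N`), `K = 𝒪_{ℙ(N)}(−1)|_Z`, `ζ = c₁(𝒪(1))`, `[Z̃] = c₈(π^*M ⊗ 𝒪(1))`, `π_* ζ^{4+j} = s_j(N)`,
`c(N)s(N) = 1` [Fulton 1998, §3.1–3.2; §14.4 p. 246]. Hence `i_*1 = c₄(M − N)` and `i_* c₁(K) = −c₅(M − N)`;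
`N_{Z/P₀} = K^∨ ⊗ C`, `c₁(C) = c₁(M − N)|_Z + c₁(K)`, so `i_* c₁(N_{Z/P₀}) = c₁c₄ + 3c₅` (`c_k = c_k(M − N)`),
a gauge-invariant polynomial (`c₁ ↦ c₁ + 3ℓ`, `c₅ ↦ c₅ − c₄ℓ`). If `Z` is Bloch-semiregular it deforms along the Weil
family (its class stays Hodge there), so the flat transport of `i_* c₁(N_Z)` is Hodge on the very general member, whose
degree-10 Hodge classes are `ℚh⁵` (`h ∪ W = 0`): NECESSARY CONDITION (V₄¹) `c₁c₄ + 3c₅ ∈ ℚh⁵` in `H¹⁰(P₀, ℚ)`.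
`H¹⁰(J×J, ℚ)_{Hdg} = Sym⁵NS / V₁₀` (`V₁₀` = span of fifth powers of rank-one classes `(f^*θ)⁵ = 0`, dim 11 = 21 − 10);
on ℤ/4-invariant quintics `a₁h⁵ + a₂h³z z̄ + a₃h(z z̄)² + a₄h·Re z⁴ + a₅h·Im z⁴` the relations are spanned by
`8h⁵ + 40h³z z̄ + 15h(z z̄)² (+ weight-8)` (`relation_avg`) and `h z⁴, h z̄⁴`, so (V₄¹) ⟺ `3a₂ = 8a₃`. -/

/-- fifth Whitney class `s₅ = c₅(M − N)` -/
def s₅ : R := cM w₁ w₂ s 5 - cN w₁ w₂ s 1 * s₄ w₁ w₂ s - cN w₁ w₂ s 2 * s₃ w₁ w₂ s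
  - cN w₁ w₂ s 3 * s₂ w₁ w₂ s - cN w₁ w₂ s 4 * s₁ w₁ w₂ s - cN w₁ w₂ s 5

/-- the degree-10 class `120·(c₁c₄ + 3c₅)` of the design, in the ℤ/4-invariant basis
`h⁵, h³(D²+S²), h(D²+S²)², h·Re z⁴, h·Im z⁴` (`z z̄ = D² + S²`). -/
def target5 : R := 34947560160 * h w₁ w₂ ^ 5 + 237245760 * h w₁ w₂ ^ 3 * ((w₁ - w₂) ^ 2 + s ^ 2)
  - 223560 * h w₁ w₂ * ((w₁ - w₂) ^ 2 + s ^ 2) ^ 2 + 1325160 * h w₁ w₂ * reZ4 w₁ w₂ s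
  - 311040 * h w₁ w₂ * imZ4 w₁ w₂ s

/-- **Whitney form, degree 10.** `120·(s₁ s₄ + 3 s₅) = target5`. -/
theorem whitney_deg10 : 120 * (s₁ w₁ w₂ s * s₄ w₁ w₂ s + 3 * s₅ w₁ w₂ s) = target5 w₁ w₂ s := by
  simp only [s₅, s₄, s₃, s₂, s₁, cM, cN, Mcls, Ncls, Mtab, Ntab, List.map, cls, esy, target5, h, reZ4, imZ4]
  norm_num
  ring

/-- **Newton form, degree 10.** With `N₄ = 24c₄`, `N₅ = 120c₅ = p₁⁵ − 10p₁³p₂ + 15p₁p₂² + 20p₁²p₃ − 20p₂p₃ − 30p₁p₄ + 24p₅`: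
`5·p₁·N₄ + 3·N₅ = 120(c₁c₄ + 3c₅) = target5`. -/
theorem newton_deg10 :
    5 * p w₁ w₂ s 1 * (p w₁ w₂ s 1 ^ 4 - 6 * p w₁ w₂ s 1 ^ 2 * p w₁ w₂ s 2 + 3 * p w₁ w₂ s 2 ^ 2
      + 8 * p w₁ w₂ s 1 * p w₁ w₂ s 3 - 6 * p w₁ w₂ s 4)
      + 3 * (p w₁ w₂ s 1 ^ 5 - 10 * p w₁ w₂ s 1 ^ 3 * p w₁ w₂ s 2 + 15 * p w₁ w₂ s 1 * p w₁ w₂ s 2 ^ 2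
      + 20 * p w₁ w₂ s 1 ^ 2 * p w₁ w₂ s 3 - 20 * p w₁ w₂ s 2 * p w₁ w₂ s 3 - 30 * p w₁ w₂ s 1 * p w₁ w₂ s 4
      + 24 * p w₁ w₂ s 5) = target5 w₁ w₂ s := by
  simp only [p, Mcls, Ncls, Mtab, Ntab, List.map, cls, psum, target5, h, reZ4, imZ4]
  push_cast
  ring

/-- The ℤ/4-average of the basic relation `(m^*θ)⁵ = (h + S)⁵ = 0` (orbit `S, −D, −S, D`):
`2·Σ = 8h⁵ + 40h³(D²+S²) + 15h(D²+S²)² + 5h·Re z⁴` — the weight-0 relation vector `(8, 40, 15)`. -/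
theorem relation_avg (h D S : R) :
    2 * ((h + S) ^ 5 + (h - D) ^ 5 + (h - S) ^ 5 + (h + D) ^ 5)
      = 8 * h ^ 5 + 40 * h ^ 3 * (D ^ 2 + S ^ 2) + 15 * h * (D ^ 2 + S ^ 2) ^ 2
        + 5 * h * (D ^ 4 - 6 * D ^ 2 * S ^ 2 + S ^ 4) := by
  ring

/-- orbit sum of cubes: `Σ X_k³ = 4α³h³ + 6α r·h(D²+S²)` (`r = β² + γ²`). -/
theorem orbit_sum_cube (α β γ h D S : R) :
    (α * h + β * D + γ * S) ^ 3 + (α * h - γ * D + β * S) ^ 3 + (α * h - β * D - γ * S) ^ 3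
      + (α * h + γ * D - β * S) ^ 3 = 4 * α ^ 3 * h ^ 3 + 6 * α * (β ^ 2 + γ ^ 2) * h * (D ^ 2 + S ^ 2) := by
  ring

/-- orbit sum of fifth powers: `2·Σ X_k⁵ = 8α⁵h⁵ + 40α³r·h³(D²+S²) + 15α r²·h(D²+S²)² + 5α(Re a⁴·Re z⁴ + Im a⁴·Im z⁴)·h`. -/
theorem orbit_sum_fifth (α β γ h D S : R) :
    2 * ((α * h + β * D + γ * S) ^ 5 + (α * h - γ * D + β * S) ^ 5 + (α * h - β * D - γ * S) ^ 5
      + (α * h + γ * D - β * S) ^ 5)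
      = 8 * α ^ 5 * h ^ 5 + 40 * α ^ 3 * (β ^ 2 + γ ^ 2) * h ^ 3 * (D ^ 2 + S ^ 2)
        + 15 * α * (β ^ 2 + γ ^ 2) ^ 2 * h * (D ^ 2 + S ^ 2) ^ 2
        + 5 * α * h * ((β ^ 4 - 6 * β ^ 2 * γ ^ 2 + γ ^ 4) * (D ^ 4 - 6 * D ^ 2 * S ^ 2 + S ^ 4)
          + (4 * β ^ 3 * γ - 4 * β * γ ^ 3) * (4 * D ^ 3 * S - 4 * D * S ^ 3)) := by
  ring

/-- Doubling every class (for global generation of the differences) multiplies the class by `2⁴`. -/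
theorem target_double : target (2 * w₁) (2 * w₂) (2 * s) = 16 * target w₁ w₂ s := by
  simp only [target, h, reZ4, imZ4]; ring

/-! ### The moment method (generic orbit sums) -/

/-- orbit of `X = α h + β D + γ S` under the quarter turn `(β, γ) ↦ (−γ, β)`: the sum of squares. -/
theorem orbit_sum_sq (α β γ h D S : R) :
    (α * h + β * D + γ * S) ^ 2 + (α * h - γ * D + β * S) ^ 2 + (α * h - β * D - γ * S) ^ 2
      + (α * h + γ * D - β * S) ^ 2 = 4 * α ^ 2 * h ^ 2 + 2 * (β ^ 2 + γ ^ 2) * (D ^ 2 + S ^ 2) := by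
  ring

/-- orbit sum of fourth powers: `2·Σ X_k⁴ = 8α⁴h⁴ + 24α²r·h²(D²+S²) + 3r²(D²+S²)² + Re(a⁴)·Re z⁴ + Im(a⁴)·Im z⁴`
with `a = β + iγ`, `r = |a|²`. -/
theorem orbit_sum_fourth (α β γ h D S : R) :
    2 * ((α * h + β * D + γ * S) ^ 4 + (α * h - γ * D + β * S) ^ 4 + (α * h - β * D - γ * S) ^ 4
      + (α * h + γ * D - β * S) ^ 4)
      = 8 * α ^ 4 * h ^ 4 + 24 * α ^ 2 * (β ^ 2 + γ ^ 2) * h ^ 2 * (D ^ 2 + S ^ 2)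
        + 3 * (β ^ 2 + γ ^ 2) ^ 2 * (D ^ 2 + S ^ 2) ^ 2
        + (β ^ 4 - 6 * β ^ 2 * γ ^ 2 + γ ^ 4) * (D ^ 4 - 6 * D ^ 2 * S ^ 2 + S ^ 4)
        + (4 * β ^ 3 * γ - 4 * β * γ ^ 3) * (4 * D ^ 3 * S - 4 * D * S ^ 3) := by
  ring

end ClassIdentity

/-! ### (V₄¹) verdict and the moment calculus in the gauged frame -/

/-- **(V₄¹) FAILS for this design**: the survival functional `3·a₂ − 8·a₃` (which kills `h⁵`, the relation vector
`(8, 40, 15)` and the weight-±8 terms) does not vanish on `120(c₁c₄ + 3c₅)`: `3·237245760 − 8·(−223560) = 713525760`. -/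
theorem survival_deg10_fails : 3 * (237245760 : ℤ) - 8 * (-223560) = 713525760 ∧ (713525760 : ℤ) ≠ 0 := by
  norm_num

/-- the functional kills the relation vector `(8, 40, 15)`: `3·40 − 8·15 = 0`. -/
theorem survival_functional_kills_relation : 3 * (40 : ℤ) - 8 * 15 = 0 := by norm_num

/-- Moment calculus, gauged frame (`p₁ = 0`; signed (+,+,−) squares of radii (20, 9, 17) at heights `a₁ a₂ a₃`, axis point
of sign − at `b = 4(a₁ + a₂ − a₃)`): the cubic-in-heights part `X = 120μ₃ − 30Aμ₁ − 120A₃` and the linear part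
`Y = 45ν − 720μ₁` of `10(c₁c₄ + 3c₅)`'s weight-0 coefficients (`h³z z̄`, `h(z z̄)²`); `D₁₀ = 3X − 8Y`. -/
def Xcub (a₁ a₂ a₃ : ℤ) : ℤ :=
  let b := 4 * (a₁ + a₂ - a₃)
  let A := 4 * (a₁ ^ 2 + a₂ ^ 2 - a₃ ^ 2) - b ^ 2
  let A₃ := 4 * (a₁ ^ 3 + a₂ ^ 3 - a₃ ^ 3) - b ^ 3
  let μ₁ := 20 * a₁ + 9 * a₂ - 17 * a₃
  let μ₃ := 20 * a₁ ^ 3 + 9 * a₂ ^ 3 - 17 * a₃ ^ 3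
  120 * μ₃ - 30 * A * μ₁ - 120 * A₃

def Ylin (a₁ a₂ a₃ : ℤ) : ℤ :=
  45 * (400 * a₁ + 81 * a₂ - 289 * a₃) - 720 * (20 * a₁ + 9 * a₂ - 17 * a₃)

/-- purity condition (i) `A·ρ₁ = 6μ₂` with `ρ₁ = 12`, as a conic in the heights -/
def conicI (a₁ a₂ a₃ : ℤ) : ℤ :=
  44 * a₁ ^ 2 + 33 * a₂ ^ 2 + 23 * a₃ ^ 2 + 64 * a₁ * a₂ - 64 * a₁ * a₃ - 64 * a₂ * a₃

/-- cross-check of the moment formulas against the kernel-certified expansion `target5`: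
at the design's heights `(−27, −18, −36)`, `12·X = 237245760` and `12·Y = −223560`. -/
theorem moments_match_target5 : 12 * Xcub (-27) (-18) (-36) = 237245760 ∧ 12 * Ylin (-27) (-18) (-36) = -223560 := by
  decide

/-- rational points of conic (i) through `(3, 2, 4)`: `(99m² + 124m − 4, −2m² − 8m + 88, 132m² + 256m + 176)` -/
theorem conicI_param {R : Type*} [CommRing R] (m : R) :
    44 * (99 * m ^ 2 + 124 * m - 4) ^ 2 + 33 * (-2 * m ^ 2 - 8 * m + 88) ^ 2 + 23 * (132 * m ^ 2 + 256 * m + 176) ^ 2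
      + 64 * (99 * m ^ 2 + 124 * m - 4) * (-2 * m ^ 2 - 8 * m + 88)
      - 64 * (99 * m ^ 2 + 124 * m - 4) * (132 * m ^ 2 + 256 * m + 176)
      - 64 * (-2 * m ^ 2 - 8 * m + 88) * (132 * m ^ 2 + 256 * m + 176) = 0 := by
  ring

/-- sign samples of `X` (large-scale sign of `D₁₀`) and `Y` on the admissible arc `m ∈ (−2.155, −1.545)` of conic (i)
(heights = −(point), points scaled to integers): `m = −21/10, −2, −8/5, −39/25`. `X > 0` at all four; `Y` changes sign. -/
theorem arc_samples :
    conicI (-17219) (-9598) (-22052) = 0 ∧ conicI (-3) (-2) (-4) = 0 ∧ conicI (-1276) (-2392) (-2608) = 0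
      ∧ conicI (-27179) (-59758) (-61172) = 0
      ∧ 0 < Xcub (-17219) (-9598) (-22052) ∧ 0 < Xcub (-3) (-2) (-4) ∧ 0 < Xcub (-1276) (-2392) (-2608)
      ∧ 0 < Xcub (-27179) (-59758) (-61172)
      ∧ Ylin (-3) (-2) (-4) < 0 ∧ 0 < Ylin (-1276) (-2392) (-2608) := by
  decide

/-! ### Pen checks of the memo (signed configuration: squares (+,r=20,α=−27), (+,9,−18), (−,17,−36); axis (−,−36)) -/

/-- (ii) `4(Σ ε r)² = 3 Σ ε r²` -/
theorem check_ii : 4 * (20 + 9 - 17 : ℤ) ^ 2 = 3 * (20 ^ 2 + 9 ^ 2 - 17 ^ 2) := by norm_num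
/-- (i) `A·Σ ε r = 6 Σ ε α² r` with `A = 4 Σ ε α² + η β²` -/
theorem check_i :
    (4 * (27 ^ 2 + 18 ^ 2 - 36 ^ 2) - 36 ^ 2 : ℤ) * (20 + 9 - 17)
      = 6 * (20 * 27 ^ 2 + 9 * 18 ^ 2 - 17 * 36 ^ 2) := by norm_num
/-- gauge `p₁ = 0`: `4 Σ ε α + η β = 0` -/
theorem check_gauge : 4 * ((-27) + (-18) - (-36) : ℤ) - (-36) = 0 := by norm_num
/-- radii are norms from `ℚ(i)`: `20 = |4+2i|²`, `9 = |3|²`, `17 = |4+i|²` -/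
theorem check_norms : (4 ^ 2 + 2 ^ 2 : ℤ) = 20 ∧ (3 ^ 2 + 0 ^ 2 : ℤ) = 9 ∧ (4 ^ 2 + 1 ^ 2 : ℤ) = 17 := by
  norm_num
/-- `W = Σ ε a⁴ = (4+2i)⁴ + 3⁴ − (4+i)⁴ = −192 + 144 i ≠ 0` (real and imaginary parts) -/
theorem check_W :
    ((4 : ℤ) ^ 4 - 6 * 4 ^ 2 * 2 ^ 2 + 2 ^ 4) + 3 ^ 4 - (4 ^ 4 - 6 * 4 ^ 2 * 1 ^ 2 + 1 ^ 4) = -192 ∧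
    ((4 : ℤ) * 4 ^ 3 * 2 - 4 * 4 * 2 ^ 3) + 0 - (4 * 4 ^ 3 * 1 - 4 * 4 * 1 ^ 3) = 144 := by
  norm_num
/-- `q = (A² − 2C)/8 = 2106081 = 3⁹ · 107 > 0` -/
theorem check_q :
    ((4 * (27 ^ 2 + 18 ^ 2 - 36 ^ 2) - 36 ^ 2 : ℤ) ^ 2
        - 2 * (4 * (27 ^ 4 + 18 ^ 4 - 36 ^ 4) - 36 ^ 4)) = 8 * 2106081 ∧
      (2106081 : ℤ) = 3 ^ 9 * 107 := by
  norm_num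

/-- the rational parametrisation of the radius conic (ii) `r₁² + r₂² + 7r₃² + 8r₁r₂ − 8r₃(r₁ + r₂) = 0`
(signs (+,+,−)); `(a,b) = (4,−1)` gives `(40, 18, 34) ∼ (20, 9, 17)`. -/
theorem conic_ii_param {R : Type*} [CommRing R] (a b : R) :
    let r₁ := a * (a - 6 * b)
    let r₂ := -6 * b * (a + b)
    let r₃ := a ^ 2 - 6 * a * b - 6 * b ^ 2
    r₁ ^ 2 + r₂ ^ 2 + 7 * r₃ ^ 2 + 8 * r₁ * r₂ - 8 * r₃ * (r₁ + r₂) = 0 := by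
  intro r₁ r₂ r₃
  simp only [r₁, r₂, r₃]
  ring

/-! ### The canonical-class tower: gauge invariance of the push-forward polynomials, and the degree-12 lever

For `Z = D_{e−1}(φ)`, `φ : N → M` of virtual rank 3 (`c_k = c_k(M − N)`, `k = c₁(K)`, `i_* k^j = (−1)^j c_{4+j}`):
`i_* c₁(N_Z) = c₁c₄ + 3c₅`, `i_* c₁(N_Z)² = c₁²c₄ + 6c₁c₅ + 9c₆`, `i_* c₂(N_Z) = c₂c₄ + 2c₁c₅ + 3c₆`
(`N_Z = K^∨ ⊗ C`, `c(C) = c(M − N)|_Z · (1 + k)`). Twisting `M`, `N` by a line bundle `ℓ` (the gauge) acts on a virtual rank-3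
class by `c₁ ↦ c₁ + 3ℓ`, `c₂ ↦ c₂ + 2c₁ℓ + 3ℓ²`, `c₄ ↦ c₄`, `c₅ ↦ c₅ − c₄ℓ`, `c₆ ↦ c₆ − 2c₅ℓ + c₄ℓ²`
(`c_k(V ⊗ ℓ) = Σ_j binom(3 − j, k − j) c_j ℓ^{k−j}`); the three polynomials are invariant — a consistency certificate for the
dictionary. -/

theorem tower_deg10_gauge {R : Type*} [CommRing R] (c₁ c₄ c₅ ℓ : R) :
    (c₁ + 3 * ℓ) * c₄ + 3 * (c₅ - c₄ * ℓ) = c₁ * c₄ + 3 * c₅ := by ring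

theorem tower_deg12a_gauge {R : Type*} [CommRing R] (c₁ c₄ c₅ c₆ ℓ : R) :
    (c₁ + 3 * ℓ) ^ 2 * c₄ + 6 * (c₁ + 3 * ℓ) * (c₅ - c₄ * ℓ) + 9 * (c₆ - 2 * c₅ * ℓ + c₄ * ℓ ^ 2)
      = c₁ ^ 2 * c₄ + 6 * c₁ * c₅ + 9 * c₆ := by ring

theorem tower_deg12b_gauge {R : Type*} [CommRing R] (c₁ c₂ c₄ c₅ c₆ ℓ : R) :
    (c₂ + 2 * c₁ * ℓ + 3 * ℓ ^ 2) * c₄ + 2 * (c₁ + 3 * ℓ) * (c₅ - c₄ * ℓ) + 3 * (c₆ - 2 * c₅ * ℓ + c₄ * ℓ ^ 2)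
      = c₂ * c₄ + 2 * c₁ * c₅ + 3 * c₆ := by ring

/-- `c₂(K^∨ ⊗ C)` for `rk C = 4`, `c₁(K^∨) = −k`, `c₁(C) = c₁ + k`, `c₂(C) = c₂ + c₁k`: equals `c₂ − 2c₁k + 3k²`;
and `c₁(K^∨ ⊗ C) = c₁ − 3k`. -/
theorem normal_bundle_c1c2 {R : Type*} [CommRing R] (c₁ c₂ k : R) :
    (c₁ + k) + 4 * (-k) = c₁ - 3 * k ∧
      (c₂ + c₁ * k) + 3 * (c₁ + k) * (-k) + 6 * (-k) ^ 2 = c₂ - 2 * c₁ * k + 3 * k ^ 2 := by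
  constructor <;> ring

/-- INTERSECTION NUMBERS on `P₀ = J × J` (`∫ θ_M⁸ = 8!·det(M)⁴`, `det = α² − β² − γ²` for `αh + βD + γS`; coefficient extraction):
`∫h⁸ = 40320`, `∫h⁶D² = ∫h⁶S² = −5760`, `∫h⁴D⁴ = ∫h⁴S⁴ = 3456`, `∫h⁴D²S² = 1152`; hence `∫h⁶·z z̄ = −11520`, `∫h⁴(z z̄)² = 9216`
(`28·(−5760) = −4·40320`, `70·3456 = 6·40320`, `420·1152 = 12·40320`). -/
theorem intersection_numbers :
    (28 : ℤ) * (-5760) = -4 * 40320 ∧ (70 : ℤ) * 3456 = 6 * 40320 ∧ (420 : ℤ) * 1152 = 12 * 40320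
      ∧ (-5760 : ℤ) + (-5760) = -11520 ∧ (3456 : ℤ) + 2 * 1152 + 3456 = 9216 := by
  norm_num

/-- **THE DEGREE-12 LEVER.** `h⁴·z z̄ ∉ ℚh⁶` in `H¹²(P₀, ℚ)`: no `λ` has `∫h⁶·z z̄ = λ∫h⁸` and `∫h⁴(z z̄)² = λ∫h⁶ z z̄`.
Consequence (pen): `i_* c₂(N_Z)`, `i_* c₁(N_Z)² ∈ ℚh⁶` (both flat-transported Hodge on the very general Weil member) give, in
the gauge `c₁ = 0`, `c₂c₄ ∈ ℚh⁶ + (relations)`, i.e. `q·B·h⁴ z z̄ ∈ ℚh⁶ + rel` with `B` = the `z z̄`-coefficient of `p₂`, so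
`B = ½(Σ_M |c_m|² − Σ_N |c_n|²) = 0`: RADII BALANCE (E1). -/
theorem deg12_lever : ¬ ∃ l : ℚ, (-11520 : ℚ) = l * 40320 ∧ (9216 : ℚ) = l * (-11520) := by
  rintro ⟨l, h1, h2⟩
  nlinarith [h1, h2]

/-- the weight-0 relation vectors in degree 6, `(16, 120, 90, 5)` (ℤ/4-average of `(h+S)⁶`, times 16) and `(8, 40, 15, 0)`
(`h·` the degree-5 one), in the basis `h⁶, h⁴ z z̄, h²(z z̄)², (z z̄)³`; `h⁴ z z̄ = (0,1,0,0)` is not in their span plus `ℚ·(1,0,0,0)`: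
the `2 × 2` minor on the last two coordinates is `120·0 − 90·... `; recorded as the determinant `−75·1 ≠ 0` of the functional
`(b₂, b₃, b₄) ↦ −75b₂ + 200b₃ − 1800b₄` evaluated at `(1, 0, 0)`. -/
theorem relation_avg6 {R : Type*} [CommRing R] (h D S : R) :
    4 * ((h + S) ^ 6 + (h - D) ^ 6 + (h - S) ^ 6 + (h + D) ^ 6)
      = 16 * h ^ 6 + 120 * h ^ 4 * (D ^ 2 + S ^ 2) + 90 * h ^ 2 * (D ^ 2 + S ^ 2) ^ 2 + 5 * (D ^ 2 + S ^ 2) ^ 3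
        + 30 * h ^ 2 * (D ^ 4 - 6 * D ^ 2 * S ^ 2 + S ^ 4) + 3 * (D ^ 2 + S ^ 2) * (D ^ 4 - 6 * D ^ 2 * S ^ 2 + S ^ 4) := by
  ring

theorem deg12_functional : (-75 : ℤ) * 120 + 200 * 90 - 1800 * 5 = 0 ∧ (-75 : ℤ) * 40 + 200 * 15 - 1800 * 0 = 0
    ∧ (-75 : ℤ) * 1 + 200 * 0 - 1800 * 0 ≠ 0 := by
  norm_num

/-- The degree-4 class equation `A·B + |E|² = 3·Σ ε r α²` (h²zz̄-coefficient of `24c₄ = 3p₂² − 6p₄`, gauge `c₁ = 0`) on the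
gauged design: `A = −2268`, `B = 24`, `E = 0`; radii 20 (heights −27, ×4), 9 (−18, ×4) on `M`, 17 (−36, ×4) and 0 on `N`. -/
theorem class_eq_h2zz :
    (4 * 729 + 4 * 324 - 5 * 1296 : ℤ) = -2268 ∧ (4 * 20 + 4 * 9 - 4 * 17 : ℤ) = 2 * 24 ∧
      (-2268 : ℤ) * 24 + 0 = 3 * (4 * 20 * 729 + 4 * 9 * 324 - 4 * 17 * 1296) := by
  norm_num

/-- Dimension count behind «Sym⁴ NS_ℚ → H⁸(J×J, ℚ) is injective»: `Σ_{a+b=8} dim Hom_{Sp(8)}(∧^a, ∧^b)` with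
multiplicity vectors of `∧^a ℚ⁸ = ⊕ V(ω_{a−2j})` equals `15 = dim Sym⁴ ℚ³`; degrees 5, 6 give 10 and 6 (kernels 11, 22). -/
theorem sp_invariant_count :
    (1 + 1 + 2 + 2 + 3 + 2 + 2 + 1 + 1 : ℕ) = Nat.choose (4 + 2) 2 ∧ (1 + 1 + 2 + 2 + 2 + 1 + 1 : ℕ) = 10 ∧
      Nat.choose (5 + 2) 2 - 10 = 11 ∧ (1 + 1 + 2 + 1 + 1 : ℕ) = 6 ∧ Nat.choose (6 + 2) 2 - 6 = 22 := by
  decide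

/-! ### THEOREM N₄(sym) — the abstract core, KERNEL

Data of a J₀-symmetric split corank-1 design at `P₀ = J × J`, reduced to heights and radii:
`u : ιU → ℚ` heights of the UNCHARGED points of `M`; `a r : ιP → ℚ` height and radius (`r ≥ 0`) of each
J₀-PAIR `{(a; c), (a; −c)}` of charged points of `M` (each pair counted twice); `b s : ιN → ℚ` heights and radii
(`s ≥ 0`) of `N`; `|U| + 2|P| = |N| + 3`; strict ampleness (A) `b n < a p`, `b n < u i`; gauge (E3)
`Σ u + 2Σ a = Σ b`; radii balance (E1) `2Σ r = Σ s > 0` (LAW GF₄ row (C2), `w ≠ 0`); degree-4 class inequality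
(E2′) `Σ s b² ≤ 2Σ r a²`. Conclusion: no such data. Proof: with `T = max b`, the gauge and ampleness give `T < 0`
and `2a_p ≤ −T`, so `a_p² < T² ≤ b_n²`; then `2Σ r a² < 2Σ r T² = Σ s T² ≤ Σ s b²`. -/

open Finset in
theorem no_symmetric_balanced_design
    {ιU ιP ιN : Type*} [Fintype ιU] [Fintype ιP] [Fintype ιN]
    (u : ιU → ℚ) (a r : ιP → ℚ) (b s : ιN → ℚ)
    (hcard : Fintype.card ιU + 2 * Fintype.card ιP = Fintype.card ιN + 3)
    (hA1 : ∀ p n, b n < a p) (hA2 : ∀ i n, b n < u i)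
    (hE3 : ∑ i, u i + 2 * ∑ p, a p = ∑ n, b n)
    (hr : ∀ p, 0 ≤ r p) (hs : ∀ n, 0 ≤ s n)
    (hE1 : 2 * ∑ p, r p = ∑ n, s n) (hpos : 0 < ∑ n, s n)
    (hE2 : ∑ n, s n * b n ^ 2 ≤ 2 * ∑ p, r p * a p ^ 2) : False := by
  classical
  -- `N` and `P` are nonempty
  have hN : (Finset.univ : Finset ιN).Nonempty := by
    rcases (Finset.univ : Finset ιN).eq_empty_or_nonempty with h | h
    · have : ∑ n, s n = 0 := by rw [h]; simp
      linarith
    · exact h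
  have hP : (Finset.univ : Finset ιP).Nonempty := by
    rcases (Finset.univ : Finset ιP).eq_empty_or_nonempty with h | h
    · have : ∑ p, r p = 0 := by rw [h]; simp
      linarith
    · exact h
  -- `T` = the maximal height on `N`
  obtain ⟨n₁, -, hn₁⟩ := Finset.exists_max_image Finset.univ b hN
  set T := b n₁ with hT
  have hbT : ∀ n, b n ≤ T := fun n => hn₁ n (Finset.mem_univ n)
  have haT : ∀ p, T < a p := fun p => hA1 p n₁
  have huT : ∀ i, T < u i := fun i => hA2 i n₁
  -- card identities over ℚ
  have hcardQ : (Fintype.card ιU : ℚ) + 2 * (Fintype.card ιP : ℚ) = (Fintype.card ιN : ℚ) + 3 := by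
    exact_mod_cast hcard
  have hmul : (Fintype.card ιU : ℚ) * T + 2 * ((Fintype.card ιP : ℚ) * T)
      = (Fintype.card ιN : ℚ) * T + 3 * T := by
    linear_combination T * hcardQ
  -- sum bounds
  have hSb : ∑ n, b n ≤ (Fintype.card ιN : ℚ) * T := by
    calc ∑ n, b n ≤ ∑ _n : ιN, T := Finset.sum_le_sum fun n _ => hbT n
      _ = (Fintype.card ιN : ℚ) * T := by simp [Finset.sum_const, Finset.card_univ]
  have hSu : (Fintype.card ιU : ℚ) * T ≤ ∑ i, u i := by
    calc (Fintype.card ιU : ℚ) * T = ∑ _i : ιU, T := by simp [Finset.sum_const, Finset.card_univ]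
      _ ≤ ∑ i, u i := Finset.sum_le_sum fun i _ => (huT i).le
  have hSa : (Fintype.card ιP : ℚ) * T < ∑ p, a p := by
    calc (Fintype.card ιP : ℚ) * T = ∑ _p : ιP, T := by simp [Finset.sum_const, Finset.card_univ]
      _ < ∑ p, a p := Finset.sum_lt_sum_of_nonempty hP fun p _ => haT p
  -- hence `T < 0`
  have hT0 : T < 0 := by linarith [hSb, hSu, hSa, hE3, hmul]
  -- every pair height satisfies `2 a p ≤ −T`
  have h2a : ∀ p₀, 2 * a p₀ ≤ -T := by
    intro p₀
    have hsplit : a p₀ + ∑ p ∈ Finset.univ.erase p₀, a p = ∑ p, a p :=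
      Finset.add_sum_erase Finset.univ a (Finset.mem_univ p₀)
    have hcardE : ((Finset.univ.erase p₀).card : ℚ) = (Fintype.card ιP : ℚ) - 1 := by
      rw [Finset.card_erase_of_mem (Finset.mem_univ p₀), Finset.card_univ]
      have : 1 ≤ Fintype.card ιP := Fintype.card_pos_iff.mpr ⟨p₀⟩
      push_cast [Nat.cast_sub this]
      ring
    have hSe : ((Fintype.card ιP : ℚ) - 1) * T ≤ ∑ p ∈ Finset.univ.erase p₀, a p := by
      calc ((Fintype.card ιP : ℚ) - 1) * T = ∑ _p ∈ Finset.univ.erase p₀, T := by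
            rw [Finset.sum_const, ← hcardE]; simp
        _ ≤ ∑ p ∈ Finset.univ.erase p₀, a p := Finset.sum_le_sum fun p _ => (haT p).le
    nlinarith [hSb, hSu, hSe, hsplit, hE3, hmul]
  -- hence `a p² < b n²` for all `p`, `n`
  have hsq : ∀ p n, a p ^ 2 < b n ^ 2 := by
    intro p n
    have h1 : T < a p := haT p
    have h2 : a p < -T := by linarith [h2a p]
    have h3 : b n ≤ T := hbT n
    nlinarith [mul_pos (sub_pos.2 h1) (sub_pos.2 h2), mul_nonneg (sub_nonneg.2 h3) (by linarith : (0:ℚ) ≤ -T - b n)]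
  -- some pair carries positive radius
  obtain ⟨p₁, hp₁⟩ : ∃ p, 0 < r p := by
    by_contra h
    simp only [not_exists, not_lt] at h
    have : ∑ p, r p ≤ 0 := Finset.sum_nonpos fun p _ => h p
    linarith
  -- compare the two sides of (E2′) through `T²`
  have hL : ∑ p, r p * a p ^ 2 < ∑ p, r p * T ^ 2 := by
    apply Finset.sum_lt_sum
    · intro p _
      exact mul_le_mul_of_nonneg_left (by nlinarith [hsq p n₁, hbT n₁]) (hr p)
    · exact ⟨p₁, Finset.mem_univ _, mul_lt_mul_of_pos_left (by nlinarith [hsq p₁ n₁]) hp₁⟩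
  have hR : ∑ n, s n * T ^ 2 ≤ ∑ n, s n * b n ^ 2 := by
    apply Finset.sum_le_sum
    intro n _
    have h3 : b n ≤ T := hbT n
    exact mul_le_mul_of_nonneg_left
      (by nlinarith [mul_nonneg (sub_nonneg.2 h3) (by linarith : (0:ℚ) ≤ -T - b n)]) (hs n)
  have hL' : ∑ p, r p * T ^ 2 = (∑ p, r p) * T ^ 2 := (Finset.sum_mul _ _ _).symm
  have hR' : ∑ n, s n * T ^ 2 = (∑ n, s n) * T ^ 2 := (Finset.sum_mul _ _ _).symm
  have key : 2 * ((∑ p, r p) * T ^ 2) = (∑ n, s n) * T ^ 2 := by rw [← hE1]; ring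
  nlinarith [hL, hR, hL', hR', key, hE2]


end H21Scratch.TransferDeterminantalSeed

/-! ### Axiom audit (expected: no `sorryAx`; `decide` proofs use no extra axioms beyond the standard three) -/
#print axioms H21Scratch.TransferDeterminantalSeed.all_differences_ample
#print axioms H21Scratch.TransferDeterminantalSeed.newton_c4
#print axioms H21Scratch.TransferDeterminantalSeed.whitney_c4
#print axioms H21Scratch.TransferDeterminantalSeed.Mtab_rot
#print axioms H21Scratch.TransferDeterminantalSeed.orbit_sum_fourth
#print axioms H21Scratch.TransferDeterminantalSeed.whitney_deg10
#print axioms H21Scratch.TransferDeterminantalSeed.newton_deg10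
#print axioms H21Scratch.TransferDeterminantalSeed.arc_samples
#print axioms H21Scratch.TransferDeterminantalSeed.no_symmetric_balanced_design
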